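import Literature.NumberTheory.EllipticCurves.TwoDescentLocalOdd
import HarnessLib

/-!
# Rank-2 observatory — the local conditions of the complete `2`-descent at an odd ADDITIVE prime
# of type `I*₂ₙ` (`v_p(e₁ - e₂) = v_p(e₁ - e₃) = 1`, `v_p(e₂ - e₃) = m ≥ 2`)

HONEST FRAMING: per-curve certified theorems and census instruments; no claim on BSD in rank ≥ 2.

Companion of `Rank2ObservatoryTwoDescentLocalMultDeep.lean` and of the tree's `local_condition_I0`
(`Literature/…/TwoDescentLocalI0.lean`, the case `m = 1`, type `I₀*`). Let `p` be an odd prime and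
`e₁, e₂, e₃ ∈ ℤ` with `v_p(e₁ - e₂) = v_p(e₁ - e₃) = 1` and `v_p(e₂ - e₃) = m ≥ 2`: the curve
`y² = (x - e₁)(x - e₂)(x - e₃)` is the quadratic twist by `p` of a curve with multiplicative reduction
`I₂₍ₘ₋₁₎`, i.e. has additive reduction of type `I*₂₍ₘ₋₁₎` at `p` (1 797 + 643 + 283 + … prime occurrences
among the 6 097 rank-2 census rows with full rational 2-torsion). At such a prime the image of
`E(ℚ_p)/2E(ℚ_p)` is the image `{1, δ(T₁), δ(T₂), δ(T₃)}` of the 2-torsion (the 2-primary part of `E(ℚ_p)`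
injects into the component group `(ℤ/2)²`). This file proves the resulting two LINEAR conditions for
every RATIONAL point `(x, y)`, `y ≠ 0` (`local_conditions_of_add_deep`), in the tree's bits
(`parityBit p a = v_p(a) mod 2`, `qrBit p a = 1` iff the `p`-unit part of `a` is a non-square mod `p`):

* (A1) `qrBit p (x - e₁) = parityBit p (x - e₁) · qrBit p (e₂ - e₁)`;
* (A2) `qrBit p (x - e₂) = parityBit p (x - e₂) · qrBit p (e₁ - e₂) + parityBit p (x - e₁) · c`, with
  `c = qrBit p ((e₂ - e₁)(e₂ - e₃)) + qrBit p (e₁ - e₂)` for even `m` and `c = qrBit p ((e₂ - e₁)(e₂ - e₃))`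
  for odd `m` (for `m = 1` these are the two conditions of `local_condition_I0`).

Proof: the elementary case analysis on `v_p(x - e₁) ≤ 0` (all three factors have the same class, which is
then a square), `≥ 2` (`x - e₂ ≡ e₁ - e₂ ≡ e₁ - e₃ ≡ x - e₃` to first order: the point maps to `δ(T₁)`),
`= 1` (then `v_p(x - e₂) ≥ 2`, `x - e₁ ≡ e₂ - e₁`, and comparing `v_p(x - e₂)` with `m`: below `m` and at
`v_p(x - e₂) = v_p(x - e₃) = m` the valuation of `y²` would be odd; above `m` the point maps to `δ(T₂)`,
and for `v_p(x - e₂) = m < v_p(x - e₃)` to `δ(T₃)`). Only statements about RATIONAL points are made.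

## References

* J. H. Silverman, *The Arithmetic of Elliptic Curves*, 2nd ed., GTM 106 (2009), Prop. X.1.4,
  Example X.1.5; Thm. VII.6.1 (component groups). [SilvermanAEC2009]
* J. E. Cremona, *Algorithms for Modular Elliptic Curves*, 2nd ed. (1997), Sec. 3.6. [CremonaAlgorithms1997]
-/

noncomputable section

open scoped Classical

set_option linter.dupNamespace false

namespace Summit.BirchSwinnertonDyer.BirchSwinnertonDyer.Rank2Observatory

open Literature.NumberTheory.EllipticCurves.TwoDescentLocal
open Literature.NumberTheory.EllipticCurves.KramerTwoDescent

variable {p : ℕ} [hp : Fact p.Prime]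
variable {e₁ e₂ e₃ : ℤ} {x y : ℚ}

/-- Linear algebra over `ℤ/2` used below. [folklore] -/
theorem zmod_two_aux' : (∀ a b c : ZMod 2, a + b + c = 0 → b = a + c) ∧ (∀ b : ZMod 2, b ≠ 0 → b = 1) ∧
    (∀ a b : ZMod 2, a + b + b = 0 → a = 0) := by
  refine ⟨by decide, by decide, by decide⟩

/-- **The local conditions at an (odd) additive prime of type `I*₂ₙ`.** Let `p` be a prime with
`v_p(e₁ - e₂) = v_p(e₁ - e₃) = 1`, `v_p(e₂ - e₃) = m ≥ 2` (`eᵢ ∈ ℤ`). For every rational point `(x, y)`,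
`y ≠ 0`, of `y² = (x - e₁)(x - e₂)(x - e₃)`:
(A1) `qrBit p (x - e₁) = parityBit p (x - e₁) · qrBit p (e₂ - e₁)`;
(A2, `m` even) `qrBit p (x - e₂) = parityBit p (x - e₂) · qrBit p (e₁ - e₂) +
  parityBit p (x - e₁) · (qrBit p ((e₂ - e₁)(e₂ - e₃)) + qrBit p (e₁ - e₂))`;
(A2, `m` odd) `qrBit p (x - e₂) = parityBit p (x - e₂) · qrBit p (e₁ - e₂) +
  parityBit p (x - e₁) · qrBit p ((e₂ - e₁)(e₂ - e₃))`.
(The oddness of `p` is not used by the proof; the observatory applies the lemma at odd primes only.) [cite: SilvermanAEC2009, Prop. X.1.4] [cite: CremonaAlgorithms1997, Sec. 3.6] -/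
theorem local_conditions_of_add_deep (h₁₂ : padicValRat p ((e₁ : ℚ) - e₂) = 1)
    (h₁₃ : padicValRat p ((e₁ : ℚ) - e₃) = 1) {m : ℕ} (hm : 2 ≤ m) (h₂₃ : padicValRat p ((e₂ : ℚ) - e₃) = m)
    (hy : y ≠ 0) (h : y ^ 2 = (x - e₁) * (x - e₂) * (x - e₃)) :
    qrBit p (x - e₁) = parityBit p (x - e₁) * qrBit p ((e₂ : ℚ) - e₁) ∧
      (Even m → qrBit p (x - e₂) = parityBit p (x - e₂) * qrBit p ((e₁ : ℚ) - e₂) +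
        parityBit p (x - e₁) * (qrBit p (((e₂ : ℚ) - e₁) * ((e₂ : ℚ) - e₃)) + qrBit p ((e₁ : ℚ) - e₂))) ∧
      (¬ Even m → qrBit p (x - e₂) = parityBit p (x - e₂) * qrBit p ((e₁ : ℚ) - e₂) +
        parityBit p (x - e₁) * qrBit p (((e₂ : ℚ) - e₁) * ((e₂ : ℚ) - e₃))) := by
  obtain ⟨hx₁, hx₂, hx₃⟩ := factors_ne_zero hy h
  have hsum := even_sum_padicValRat (p := p) hy h
  have hbits := qrBit_add_add_eq_zero (p := p) hy h
  obtain ⟨auxb, aux1, auxc⟩ := zmod_two_aux'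
  have hm1 : (1 : ℤ) < m := by exact_mod_cast hm
  -- the constants
  have he₁₂ : (e₁ : ℚ) - e₂ ≠ 0 := by
    intro h0; rw [h0, padicValRat.zero] at h₁₂; exact zero_ne_one h₁₂
  have he₁₃ : (e₁ : ℚ) - e₃ ≠ 0 := by
    intro h0; rw [h0, padicValRat.zero] at h₁₃; exact zero_ne_one h₁₃
  have he₂₃ : (e₂ : ℚ) - e₃ ≠ 0 := by
    intro h0; rw [h0, padicValRat.zero] at h₂₃; exact absurd h₂₃.symm (by exact_mod_cast (show m ≠ 0 by omega))
  have he₂₁ : (e₂ : ℚ) - e₁ ≠ 0 := by rw [show (e₂ : ℚ) - e₁ = -((e₁ : ℚ) - e₂) by ring]; exact neg_ne_zero.mpr he₁₂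
  have he₃₂ : (e₃ : ℚ) - e₂ ≠ 0 := by rw [show (e₃ : ℚ) - e₂ = -((e₂ : ℚ) - e₃) by ring]; exact neg_ne_zero.mpr he₂₃
  have hv₂₁ : padicValRat p ((e₂ : ℚ) - e₁) = 1 := by
    rw [show (e₂ : ℚ) - e₁ = -((e₁ : ℚ) - e₂) by ring, padicValRat.neg, h₁₂]
  have hv₃₂ : padicValRat p ((e₃ : ℚ) - e₂) = m := by
    rw [show (e₃ : ℚ) - e₂ = -((e₂ : ℚ) - e₃) by ring, padicValRat.neg, h₂₃]
  -- qrBit of the constants: `e₁ - e₃ ≡ e₁ - e₂` (to second order), signs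
  have hn1 : (-1 : ℚ) ≠ 0 := by norm_num
  have q₁₃ : qrBit p ((e₁ : ℚ) - e₃) = qrBit p ((e₁ : ℚ) - e₂) :=
    qrBit_congr p (by
      rw [show (e₁ : ℚ) - e₃ = ((e₁ : ℚ) - e₂) + ((e₂ : ℚ) - e₃) by ring,
        res_add_of_lt p he₁₂ (Or.inr (by rw [h₁₂, h₂₃]; exact hm1))])
  have qa : qrBit p ((e₁ : ℚ) - e₂) = qrBit p (-1) + qrBit p ((e₂ : ℚ) - e₁) := by
    rw [show (e₁ : ℚ) - e₂ = (-1) * ((e₂ : ℚ) - e₁) by ring, qrBit_mul p hn1 he₂₁]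
  have qd : qrBit p (((e₂ : ℚ) - e₁) * ((e₂ : ℚ) - e₃)) = qrBit p ((e₂ : ℚ) - e₁) + qrBit p ((e₂ : ℚ) - e₃) :=
    qrBit_mul p he₂₁ he₂₃
  have q₃₂ : qrBit p ((e₃ : ℚ) - e₂) = qrBit p (-1) + qrBit p ((e₂ : ℚ) - e₃) := by
    rw [show (e₃ : ℚ) - e₂ = (-1) * ((e₂ : ℚ) - e₃) by ring, qrBit_mul p hn1 he₂₃]
  -- the relations between the factors
  have r₂ : x - e₂ = (x - e₁) + ((e₁ : ℚ) - e₂) := by ring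
  have r₃ : x - e₃ = (x - e₁) + ((e₁ : ℚ) - e₃) := by ring
  have r₁' : x - e₁ = ((e₂ : ℚ) - e₁) + (x - e₂) := by ring
  have r₃' : x - e₃ = (x - e₂) + ((e₂ : ℚ) - e₃) := by ring
  have r₂' : x - e₂ = (x - e₃) + ((e₃ : ℚ) - e₂) := by ring
  -- parity bits from valuations
  have par_of_eq : ∀ {a : ℚ} {v : ℤ}, padicValRat p a = v → parityBit p a = (v : ZMod 2) := by
    intro a v hv; unfold parityBit; rw [hv]
  rcases lt_trichotomy (padicValRat p (x - e₁)) 1 with hlow | hone | hhigh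
  · -- Case `v(x - e₁) ≤ 0`: the three factors have the same valuation and residue
    have d₂ := padicValRat_add_eq_left (p := p) hx₁ (b := (e₁ : ℚ) - e₂) (Or.inr (by rw [h₁₂]; exact hlow))
    have d₃ := padicValRat_add_eq_left (p := p) hx₁ (b := (e₁ : ℚ) - e₃) (Or.inr (by rw [h₁₃]; exact hlow))
    rw [← r₂] at d₂
    rw [← r₃] at d₃
    have heven : Even (padicValRat p (x - e₁)) := by
      rw [d₂.2, d₃.2] at hsum
      obtain ⟨k, hk⟩ := hsum
      exact ⟨k - padicValRat p (x - e₁), by omega⟩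
    have q₂ : qrBit p (x - e₂) = qrBit p (x - e₁) :=
      qrBit_congr p (by rw [r₂, res_add_of_lt p hx₁ (Or.inr (by rw [h₁₂]; exact hlow))])
    have q₃ : qrBit p (x - e₃) = qrBit p (x - e₁) :=
      qrBit_congr p (by rw [r₃, res_add_of_lt p hx₁ (Or.inr (by rw [h₁₃]; exact hlow))])
    rw [q₂, q₃] at hbits
    have hq₁ : qrBit p (x - e₁) = 0 := auxc _ _ hbits
    have hpar₁ : parityBit p (x - e₁) = 0 := parityBit_eq_zero_iff.mpr heven
    have hpar₂ : parityBit p (x - e₂) = 0 := by rw [parityBit_eq_zero_iff, d₂.2]; exact heven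
    refine ⟨by rw [hq₁, hpar₁, zero_mul], fun _ => ?_, fun _ => ?_⟩
    · rw [q₂, hq₁, hpar₁, hpar₂, zero_mul, zero_mul, add_zero]
    · rw [q₂, hq₁, hpar₁, hpar₂, zero_mul, zero_mul, add_zero]
  · -- Case `v(x - e₁) = 1`: then `v(x - e₂) ≥ 2` and `x - e₁ ≡ e₂ - e₁`
    have hpar₁ : parityBit p (x - e₁) = 1 := by rw [par_of_eq hone, Int.cast_one]
    rcases lt_trichotomy (padicValRat p (x - e₂)) 1 with h2lt | h2eq | h2gt
    · -- `v(x - e₂) < 1` is impossible (it would force `v(x - e₁) = v(x - e₂) < 1`)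
      exfalso
      have d := padicValRat_add_eq_left (p := p) hx₂ (b := (e₂ : ℚ) - e₁) (Or.inr (by rw [hv₂₁]; exact h2lt))
      rw [add_comm, ← r₁'] at d
      rw [d.2] at hone
      exact absurd hone h2lt.ne
    · -- `v(x - e₂) = 1`: then `v(x - e₃) = 1` and `v(y²) = 3`, impossible
      exfalso
      have d := padicValRat_add_eq_left (p := p) hx₂ (b := (e₂ : ℚ) - e₃) (Or.inr (by rw [h2eq, h₂₃]; exact hm1))
      rw [← r₃'] at d
      rw [hone, h2eq, d.2, h2eq] at hsum
      obtain ⟨k, hk⟩ := hsum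
      omega
    · -- `v(x - e₂) ≥ 2`: `x - e₁ ≡ e₂ - e₁`, (A1) holds; compare `v(x - e₂)` with `m` for (A2)
      have q₁ : qrBit p (x - e₁) = qrBit p ((e₂ : ℚ) - e₁) :=
        qrBit_congr p (by rw [r₁', res_add_of_lt p he₂₁ (Or.inr (by rw [hv₂₁]; exact h2gt))])
      refine ⟨by rw [q₁, hpar₁, one_mul], ?_⟩
      rcases lt_trichotomy (padicValRat p (x - e₂)) m with hlt | heq | hgt
      · -- below `m`: `v(x - e₃) = v(x - e₂)` and `v(y²) = 1 + 2 v(x - e₂)` is odd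
        exfalso
        have d := padicValRat_add_eq_left (p := p) hx₂ (b := (e₂ : ℚ) - e₃) (Or.inr (by rw [h₂₃]; exact hlt))
        rw [← r₃'] at d
        rw [hone, d.2] at hsum
        obtain ⟨k, hk⟩ := hsum
        omega
      · -- `v(x - e₂) = m ≤ v(x - e₃)`
        have d := le_padicValRat_add_or (p := p) (a := x - e₂) (b := (e₂ : ℚ) - e₃) (c := (m : ℤ))
          (Or.inr (by rw [heq])) (Or.inr (by rw [h₂₃]))
        rw [← r₃'] at d
        rcases d with d | d
        · exact absurd d hx₃
        rcases (show padicValRat p (x - e₃) = m ∨ (m : ℤ) < padicValRat p (x - e₃) by omega) with h3 | h3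
        · -- `v(x - e₃) = m` too: `v(y²) = 1 + 2m` is odd
          exfalso
          rw [hone, heq, h3] at hsum
          obtain ⟨k, hk⟩ := hsum
          omega
        · -- `v(x - e₃) > m`: `x - e₂ ≡ e₃ - e₂`, the point maps to `δ(T₃)`
          have q₂ : qrBit p (x - e₂) = qrBit p ((e₃ : ℚ) - e₂) :=
            qrBit_congr p (by rw [r₂', add_comm, res_add_of_lt p he₃₂ (Or.inr (by rw [hv₃₂]; exact h3))])
          have hpar₂ : parityBit p (x - e₂) = (m : ZMod 2) := by rw [par_of_eq heq, Int.cast_natCast]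
          refine ⟨fun hme => ?_, fun hmo => ?_⟩
          · have hm0 : ((m : ℕ) : ZMod 2) = 0 := (ZMod.natCast_eq_zero_iff_even).mpr hme
            rw [q₂, q₃₂, hpar₂, hm0, hpar₁, zero_mul, one_mul, zero_add, qd, qa]
            generalize qrBit p (-1) = A; generalize qrBit p ((e₂ : ℚ) - e₁) = B; generalize qrBit p ((e₂ : ℚ) - e₃) = C
            revert A B C; decide
          · have hm1' : ((m : ℕ) : ZMod 2) = 1 := (ZMod.natCast_eq_one_iff_odd).mpr (Nat.not_even_iff_odd.mp hmo)
            rw [q₂, q₃₂, hpar₂, hm1', hpar₁, one_mul, one_mul, qd, qa]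
            generalize qrBit p (-1) = A; generalize qrBit p ((e₂ : ℚ) - e₁) = B; generalize qrBit p ((e₂ : ℚ) - e₃) = C
            revert A B C; decide
      · -- above `m`: `v(x - e₃) = m`, `x - e₃ ≡ e₂ - e₃`, `v(x - e₂) ≡ m + 1 (mod 2)`: the point maps to `δ(T₂)`
        have d := padicValRat_add_eq_left (p := p) he₂₃ (b := x - e₂) (Or.inr (by rw [h₂₃]; exact hgt))
        rw [add_comm, ← r₃'] at d
        have q₃ : qrBit p (x - e₃) = qrBit p ((e₂ : ℚ) - e₃) :=
          qrBit_congr p (by rw [r₃', add_comm, res_add_of_lt p he₂₃ (Or.inr (by rw [h₂₃]; exact hgt))])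
        have q₂ : qrBit p (x - e₂) = qrBit p ((e₂ : ℚ) - e₁) + qrBit p ((e₂ : ℚ) - e₃) := by
          rw [← q₁, ← q₃]; exact auxb _ _ _ hbits
        rw [hone, d.2, h₂₃] at hsum
        -- `Even (1 + v₂ + m)`
        have hv₂m : Even (padicValRat p (x - e₂)) ↔ ¬ Even (m : ℤ) := by
          constructor
          · intro h2 hme
            have : Even ((1 : ℤ) + padicValRat p (x - e₂) + m) := hsum
            rw [Int.even_add, Int.even_add] at this
            simp [h2, hme] at this
          · intro hmo
            have : Even ((1 : ℤ) + padicValRat p (x - e₂) + m) := hsum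
            rw [Int.even_add, Int.even_add] at this
            by_contra h2
            simp [h2, hmo] at this
        refine ⟨fun hme => ?_, fun hmo => ?_⟩
        · have hodd₂ : ¬ Even (padicValRat p (x - e₂)) := fun h2 => (hv₂m.mp h2) ((Int.even_coe_nat m).mpr hme)
          have hpar₂ : parityBit p (x - e₂) = 1 := aux1 _ (fun h0 => hodd₂ (parityBit_eq_zero_iff.mp h0))
          rw [q₂, hpar₂, hpar₁, one_mul, one_mul, qd, qa]
          generalize qrBit p (-1) = A; generalize qrBit p ((e₂ : ℚ) - e₁) = B; generalize qrBit p ((e₂ : ℚ) - e₃) = C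
          revert A B C; decide
        · have hev₂ : Even (padicValRat p (x - e₂)) := hv₂m.mpr (fun h2 => hmo ((Int.even_coe_nat m).mp h2))
          have hpar₂ : parityBit p (x - e₂) = 0 := parityBit_eq_zero_iff.mpr hev₂
          rw [q₂, hpar₂, hpar₁, zero_mul, one_mul, zero_add, qd]
  · -- Case `v(x - e₁) ≥ 2`: `x - e₂ ≡ e₁ - e₂`, `x - e₃ ≡ e₁ - e₃ ≡ e₁ - e₂`: the point maps to `δ(T₁)`
    have d₂ := padicValRat_add_eq_left (p := p) he₁₂ (b := x - e₁) (Or.inr (by rw [h₁₂]; exact hhigh))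
    have d₃ := padicValRat_add_eq_left (p := p) he₁₃ (b := x - e₁) (Or.inr (by rw [h₁₃]; exact hhigh))
    rw [add_comm, ← r₂] at d₂
    rw [add_comm, ← r₃] at d₃
    have heven : Even (padicValRat p (x - e₁)) := by
      rw [d₂.2, d₃.2, h₁₂, h₁₃] at hsum
      obtain ⟨k, hk⟩ := hsum
      exact ⟨k - 1, by omega⟩
    have q₂ : qrBit p (x - e₂) = qrBit p ((e₁ : ℚ) - e₂) :=
      qrBit_congr p (by rw [r₂, add_comm, res_add_of_lt p he₁₂ (Or.inr (by rw [h₁₂]; exact hhigh))])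
    have q₃ : qrBit p (x - e₃) = qrBit p ((e₁ : ℚ) - e₃) :=
      qrBit_congr p (by rw [r₃, add_comm, res_add_of_lt p he₁₃ (Or.inr (by rw [h₁₃]; exact hhigh))])
    rw [q₂, q₃, q₁₃] at hbits
    have hq₁ : qrBit p (x - e₁) = 0 := auxc _ _ hbits
    have hpar₁ : parityBit p (x - e₁) = 0 := parityBit_eq_zero_iff.mpr heven
    have hpar₂ : parityBit p (x - e₂) = 1 := by rw [par_of_eq d₂.2, h₁₂, Int.cast_one]
    refine ⟨by rw [hq₁, hpar₁, zero_mul], fun _ => ?_, fun _ => ?_⟩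
    · rw [q₂, hpar₂, hpar₁, one_mul, zero_mul, add_zero]
    · rw [q₂, hpar₂, hpar₁, one_mul, zero_mul, add_zero]

end Summit.BirchSwinnertonDyer.BirchSwinnertonDyer.Rank2Observatory

end
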